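import Literature.Barriers.Parity.SiegelZeroDichotomyChowlaLemma37
import HarnessLib

/-!
# Tao–Teräväinen 2022, Lemma 3.7 for a general set `J ⊆ H` of twisted slots — PROVED

Topic `Literature/Barriers/Parity`, sub-namespace `TaoTeravainen`; companion of
`SiegelZeroDichotomyChowlaLemma37.lean` (which proves Lemma 3.7 of T. Tao, J. Teräväinen, *The
Hardy–Littlewood–Chowla conjecture in the presence of a Siegel zero*, J. London Math. Soc. (2) 106
(2022), arXiv:2109.06291, in the case `J = H`, `d' = d`). Step (v) of the proof of Corollary 1.8(i)
(§8, `k = 2`, "From Lemma 3.7(ii) and summation by parts … we may thus bound … by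
`≪_ε q_χ^{1/2+ε} log^{O(1)} x ∑_J ∑ (d₁⋯d_k, q_χ)^{1/2} τ(d₁)^{O(1)}⋯(1/(q_χ d₁⋯d_k) + 1/x)`")
needs the lemma as printed: divisibility conditions `d_h ∣ n + h` on all slots `h ∈ H`, the
character `χ((n+h)/d'_h)` only on a non-empty subset `J ⊆ H`, with `d'_h ∣ d_h`.

* `TaoTeravainen2021_lemma37_general` — for `J ⊆ H` non-empty (`h ≥ 1` on `H`), `ε > 0`:
  `∃ C ≥ 0`, for every Siegel zero, `x`, `d_h ≥ 1`, `d'_h ∣ d_h`: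
  `|Σ_{n ≤ x} 1_{∀h, d_h∣n+h} Π_{h∈J} χ((n+h)/d'_h)| ≤ C q^{1/2+ε} √((Π d_h, q)) (x/(qΠ d_h) + 1)`.

The proof is the tree's proof of the case `J = H` with the polynomial `f(m) = Π_{h∈J}(A_h m + B_h)`,
`A_h = D/d'_h`, `B_h = (a+h)/d'_h` ("Suppose that there is a prime `p` not dividing `d` such that
`f` is a constant multiple of a square modulo `p`. Then the roots `−(a+h_j)/d` … must experience a
repetition, and hence `p` divides `h_i − h_j`"): Lemma 3.3 (`system_iff_modEq`), the progression
(`filter_mod_eq_image`), the Weil bound with bad primes (`norm_polyCharSum_le`, `cross_mul_eq`),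
completion (`norm_sum_Icc_le_of_dft_le`) and the divisor bound.
[cite: TaoTeravainen2021, Lemma 3.7]
-/

noncomputable section

open Finset Real
open Literature.NumberTheory.LFunctions.PolyCharSum (polyCharSum polyDisc norm_polyCharSum_le)

namespace Literature.Barriers.Parity

open TaoTeravainen

set_option maxHeartbeats 1600000 in
/-- **Tao–Teräväinen 2022, Lemma 3.7, general `J ⊆ H`** (`I = [1, x]`): for fixed distinct shifts `H`
(`h ≥ 1`), a non-empty `J ⊆ H` and `ε > 0` there is `C ≥ 0` such that for every Siegel zero
(`IsSiegelZero χ η`, conductor `q`), every `x ∈ ℕ`, all moduli `d_h ≥ 1` (`h ∈ H`) and all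
`d'_h ∣ d_h` (`h ∈ J`):
`|Σ_{n=1}^{x} 1_{∀ h ∈ H, d_h ∣ n+h} Π_{h ∈ J} χ((n+h)/d'_h)| ≤ C q^{1/2+ε} √((Π_H d_h, q)) (x/(q Π_H d_h) + 1)`
("Let `J` be a non-empty subset of `{1,…,k+ℓ}`, and for each `j ∈ J`, let `d'_j` be a factor of
`d_j`. Then `𝔼_{n ≤ x} 1_I(n) (∏ 1_{d_j∣n+h_j}) ∏_{j∈J} χ((n+h_j)/d'_j) ≪_ε q^{1/2+ε}(d₁⋯d_{k+ℓ},q)^{1/2}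
(1/(q d₁⋯d_{k+ℓ}) + 1/x)`"). The proof is that of the case `J = H`, `d' = d`
(`TaoTeravainen2021_lemma37_k0_holds`) verbatim, with the polynomial `∏_{h∈J}(A_h m + B_h)`,
`A_h = D/d'_h`, `B_h = (a+h)/d'_h`, `D = [d_h]_{h∈H}`.
[cite: TaoTeravainen2021, Lemma 3.7 (with Lemma 3.3 and §3.4 (3.13)–(3.16))] -/
theorem TaoTeravainen2021_lemma37_general (H J : Finset ℕ) (hJ : J.Nonempty) (hJH : J ⊆ H)
    (hH1 : ∀ h ∈ H, 1 ≤ h) {ε : ℝ} (hε : 0 < ε) :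
    ∃ C : ℝ, 0 ≤ C ∧ ∀ (q : ℕ) [NeZero q] (χ : DirichletCharacter ℂ q) (η : ℝ), IsSiegelZero χ η →
      ∀ (x : ℕ) (d d' : ℕ → ℕ), (∀ h ∈ H, 1 ≤ d h) → (∀ h ∈ J, d' h ∣ d h) →
        |∑ n ∈ Icc 1 x, (if ∀ h ∈ H, d h ∣ n + h then ∏ h ∈ J, realChar χ ((n + h) / d' h) else 0)| ≤
          C * (q : ℝ) ^ ((1 : ℝ) / 2 + ε) * Real.sqrt (Nat.gcd (∏ h ∈ H, d h) q) *
            ((x : ℝ) / ((q : ℝ) * ∏ h ∈ H, (d h : ℝ)) + 1) := by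
  classical
  have hH : H.Nonempty := hJ.mono hJH
  -- constants depending on `H` and `ε` only
  set ℓ : ℕ := #J with hℓ
  have hℓ1 : 1 ≤ ℓ := Finset.card_pos.mpr hJ
  set ℓH : ℕ := #H with hℓH
  set hmax : ℕ := H.max' hH with hhmax
  have hhmax1 : 1 ≤ hmax := (hH1 _ (H.max'_mem hH))
  have hHle : ∀ h ∈ H, h ≤ hmax := fun h hh => H.le_max' h hh
  set K : ℝ := (hmax : ℝ) ^ (ℓH * ℓH) with hK
  have hK1 : 1 ≤ K := one_le_pow₀ (by exact_mod_cast hhmax1)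
  set ΔH : ℕ := ∏ i ∈ J, ∏ j ∈ J.erase i, Int.natAbs ((j : ℤ) - i) with hΔH
  have hΔH0 : 0 < ΔH := by
    refine Finset.prod_pos fun i _ => Finset.prod_pos fun j hj => ?_
    refine Int.natAbs_pos.mpr (sub_ne_zero.mpr ?_)
    exact_mod_cast Finset.ne_of_mem_erase hj
  set δ : ℝ := ε / (4 * ℓ) with hδ
  have hδ0 : 0 < δ := by positivity
  obtain ⟨Cδ, hCδ1, hCδ⟩ := Literature.NumberTheory.Sieve.exists_card_divisors_le_mul_rpow hδ0
  set C : ℝ := 2 * (2 : ℝ) ^ ((3 : ℝ) / 2) * Cδ ^ ℓ * (1 + 4 / ε) * Real.sqrt ΔH * K with hC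
  have hC0 : 0 ≤ C := by positivity
  refine ⟨C, hC0, ?_⟩
  intro q _ χ η hSZ x d d' hd hd'
  have hq3 : 3 ≤ q := hSZ.three_le
  have hq2 : 2 ≤ q := by omega
  obtain ⟨hprim, hquad, -, -⟩ := hSZ
  have hq0 : q ≠ 0 := by omega
  have hq1 : (1 : ℝ) ≤ q := by exact_mod_cast (by omega : 1 ≤ q)
  have hqpos : (0 : ℝ) < q := by positivity
  have hP0 : 0 < ∏ h ∈ H, d h := Finset.prod_pos fun h hh => hd h hh
  have hPR : (0 : ℝ) < ∏ h ∈ H, (d h : ℝ) := Finset.prod_pos fun h hh => by exact_mod_cast hd h hh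
  -- the target quantities
  set G : ℝ := Real.sqrt (Nat.gcd (∏ h ∈ H, d h) q) with hG
  set X : ℝ := (x : ℝ) / ((q : ℝ) * ∏ h ∈ H, (d h : ℝ)) + 1 with hX
  have hG1 : 1 ≤ G := by
    rw [hG, ← Real.sqrt_one]
    exact Real.sqrt_le_sqrt (by exact_mod_cast Nat.gcd_pos_of_pos_right _ (by omega))
  have hG0 : 0 < G := zero_lt_one.trans_le hG1
  have hX1 : 1 ≤ X := le_add_of_nonneg_left (by positivity)
  have hX0 : 0 < X := zero_lt_one.trans_le hX1
  have hK0 : 0 < K := zero_lt_one.trans_le hK1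
  have hRHS : 0 ≤ C * (q : ℝ) ^ ((1 : ℝ) / 2 + ε) * G * X := by positivity
  -- the summand as an `ite` over the whole system
  set g : ℕ → ℝ := fun n => ∏ h ∈ J, realChar χ ((n + h) / d' h) with hg
  set F : ℕ → ℝ := fun n => if (∀ h ∈ H, d h ∣ n + h) then g n else 0 with hF
  have hFg : ∀ n, F n = if (∀ h ∈ H, d h ∣ n + h) then g n else 0 := fun n => rfl
  show |∑ n ∈ Icc 1 x, F n| ≤ C * (q : ℝ) ^ ((1 : ℝ) / 2 + ε) * G * X
  -- Case 1: the system has no solution in `[1, x]`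
  by_cases hsol : ∃ n₀ ∈ Icc 1 x, ∀ h ∈ H, d h ∣ n₀ + h
  swap
  · have h0 : ∑ n ∈ Icc 1 x, F n = 0 := Finset.sum_eq_zero fun n hn => by
      rw [hFg, if_neg (fun h => hsol ⟨n, hn, h⟩)]
    rw [h0, abs_zero]
    exact hRHS
  -- Case 2: a solution `n₀` exists; the modulus `D` and the residue `a`
  obtain ⟨n₀, hn₀, hsol₀⟩ := hsol
  rw [mem_Icc] at hn₀
  set D : ℕ := H.lcm d with hDdef
  have hdD : ∀ h ∈ H, d h ∣ D := fun h hh => Finset.dvd_lcm hh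
  have hDP : D ∣ ∏ h ∈ H, d h := Finset.lcm_dvd fun h hh => Finset.dvd_prod_of_mem d hh
  have hD0 : 0 < D := Nat.pos_of_dvd_of_pos hDP hP0
  set a : ℕ := n₀ % D with hadef
  have haD : a < D := Nat.mod_lt _ hD0
  have hax : a ≤ x := (Nat.mod_le _ _).trans hn₀.2
  have hmod₀ : a ≡ n₀ [MOD D] := Nat.mod_modEq n₀ D
  have hsola : ∀ h ∈ H, d h ∣ a + h := fun h hh =>
    ((hmod₀.add_right h).dvd_iff (hdD h hh)).mpr (hsol₀ h hh)
  have hd'D : ∀ h ∈ J, d' h ∣ D := fun h hh => (hd' h hh).trans (hdD h (hJH hh))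
  have hsola' : ∀ h ∈ J, d' h ∣ a + h := fun h hh => (hd' h hh).trans (hsola h (hJH hh))
  -- Step 1: restrict to the progression `n ≡ a (D)`
  have hS1 : ∑ n ∈ Icc 1 x, F n = ∑ n ∈ (Icc 1 x).filter (fun n => n % D = a), g n := by
    rw [Finset.sum_filter]
    refine Finset.sum_congr rfl fun n _ => ?_
    rw [hFg]
    by_cases hP : ∀ h ∈ H, d h ∣ n + h
    · have hc : n % D = a := (system_iff_modEq H d hsol₀ n).mp hP
      rw [if_pos hP, if_pos hc]
    · have hc : ¬ n % D = a := fun h => hP ((system_iff_modEq H d hsol₀ n).mpr h)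
      rw [if_neg hP, if_neg hc]
  -- Step 2: parametrise the progression by `m`, `n = a + D m`
  set m₀ : ℕ := if a = 0 then 1 else 0 with hm₀
  set m₁ : ℕ := (x - a) / D with hm₁
  have hS2 : ∑ n ∈ (Icc 1 x).filter (fun n => n % D = a), g n =
      ∑ m ∈ Icc m₀ m₁, g (a + D * m) := by
    rw [filter_mod_eq_image hD0 haD hax, Finset.sum_image]
    intro m _ m' _ hmm
    have hmm' : a + D * m = a + D * m' := hmm
    exact Nat.eq_of_mul_eq_mul_left hD0 (by omega)
  -- Step 3: the values on the progression are `Re Π_h χ(A_h m + B_h)`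
  set A : ℕ → ℤ := fun h => ((D / d' h : ℕ) : ℤ) with hA
  set B : ℕ → ℤ := fun h => (((a + h) / d' h : ℕ) : ℤ) with hB
  set Φ : ZMod q → ℂ := fun z => ∏ h ∈ J, χ ((A h : ZMod q) * z + (B h : ZMod q)) with hΦ
  have hval : ∀ m : ℕ, g (a + D * m) = (Φ (m : ZMod q)).re := by
    intro m
    have hc : Φ (m : ZMod q) = ((g (a + D * m) : ℝ) : ℂ) := by
      simp only [hΦ, hg]
      rw [Complex.ofReal_prod]
      refine Finset.prod_congr rfl fun h hh => ?_
      rw [realChar_coe χ hquad]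
      congr 1
      have hdiv : (a + D * m + h) / d' h = (a + h) / d' h + D / d' h * m := by
        rw [show a + D * m + h = (a + h) + D * m by ring, Nat.add_div_of_dvd_right (hsola' h hh),
          mul_comm D m, Nat.mul_div_assoc _ (hd'D h hh), mul_comm]
      rw [hdiv]
      simp only [hA, hB, Int.cast_natCast, Nat.cast_add, Nat.cast_mul]
      ring
    rw [hc, Complex.ofReal_re]
  have hS3 : ∑ m ∈ Icc m₀ m₁, g (a + D * m) = (∑ m ∈ Icc m₀ m₁, Φ (m : ZMod q)).re := by
    rw [Complex.re_sum]
    exact Finset.sum_congr rfl fun m _ => hval m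
  -- Step 4: the Fourier bounds of `Φ` from `norm_polyCharSum_le` with `R = D · Δ_H`
  set R : ℕ := D * ΔH with hRdef
  have hR : ∀ p ∈ q.primeFactors, p ≠ 2 → (p : ℤ) ∣ polyDisc J A B → p ∣ R := by
    intro p hp _ hdvd
    have hpP : p.Prime := Nat.prime_of_mem_primeFactors hp
    have hpZ : Prime (p : ℤ) := Nat.prime_iff_prime_int.mp hpP
    unfold polyDisc at hdvd
    rcases hpZ.dvd_or_dvd hdvd with h1 | h2
    · obtain ⟨h, hh, hph⟩ := hpZ.exists_mem_finset_dvd h1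
      have hpD : p ∣ D := (Int.natCast_dvd_natCast.mp hph).trans (Nat.div_dvd_of_dvd (hd'D h hh))
      exact hpD.mul_right _
    · obtain ⟨i, hi, h2'⟩ := hpZ.exists_mem_finset_dvd h2
      obtain ⟨j, hj, hpij⟩ := hpZ.exists_mem_finset_dvd h2'
      have hj' : j ∈ J := Finset.mem_of_mem_erase hj
      have hkey := cross_mul_eq (hd'D i hi) (hd'D j hj') (hsola' i hi) (hsola' j hj')
      have hpD : (p : ℤ) ∣ (D : ℤ) * ((j : ℤ) - i) := by
        rw [← hkey]; exact dvd_mul_of_dvd_right hpij _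
      rcases hpZ.dvd_or_dvd hpD with h3 | h4
      · exact (Int.natCast_dvd_natCast.mp h3).mul_right _
      · refine Dvd.dvd.mul_left ?_ _
        have h5 : p ∣ Int.natAbs ((j : ℤ) - i) := Int.natCast_dvd.mp h4
        exact h5.trans ((Finset.dvd_prod_of_mem (fun j : ℕ => Int.natAbs ((j : ℤ) - i)) hj).trans
          (Finset.dvd_prod_of_mem (fun i : ℕ => ∏ j ∈ J.erase i, Int.natAbs ((j : ℤ) - i)) hi))
  set Mq : ℝ := (2 : ℝ) ^ ((3 : ℝ) / 2) * (ℓ : ℝ) ^ q.primeFactors.card * Real.sqrt q *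
    Real.sqrt (Nat.gcd q R) with hMq
  have hM0 : ‖∑ j : ZMod q, Φ j‖ ≤ Mq := by
    rw [hΦ, sum_eq_polyCharSum]
    exact norm_polyCharSum_le hprim hquad hJ A B _ hR
  have hMk : ∀ k : ZMod q, k ≠ 0 → ‖ZMod.dft Φ k‖ ≤ Mq := fun k _ => by
    rw [hΦ, dft_eq_polyCharSum]
    exact norm_polyCharSum_le hprim hquad hJ A B _ hR
  have hS4 := norm_sum_Icc_le_of_dft_le hq2 Φ hM0 hMk m₀ m₁
  -- Step 5: numerics
  have hMqnn : 0 ≤ Mq := by positivity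
  -- (a) `Mq ≤ c₁ q^{ε/4} √q G √ΔH`
  have hℓω : (ℓ : ℝ) ^ q.primeFactors.card ≤ Cδ ^ ℓ * (q : ℝ) ^ (ε / 4) := by
    refine (pow_card_primeFactors_le ℓ hq0).trans ?_
    have hτ := hCδ q hq0
    calc ((#q.divisors : ℕ) : ℝ) ^ ℓ ≤ (Cδ * (q : ℝ) ^ δ) ^ ℓ :=
          pow_le_pow_left₀ (Nat.cast_nonneg _) hτ ℓ
      _ = Cδ ^ ℓ * (q : ℝ) ^ (ε / 4) := by
          rw [mul_pow, ← Real.rpow_natCast ((q : ℝ) ^ δ) ℓ, ← Real.rpow_mul hqpos.le]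
          congr 2
          rw [hδ]; field_simp
  have hgcd : Real.sqrt (Nat.gcd q R) ≤ G * Real.sqrt ΔH := by
    rw [hG, ← Real.sqrt_mul (Nat.cast_nonneg _)]
    refine Real.sqrt_le_sqrt ?_
    have h1 : Nat.gcd q R ≤ Nat.gcd q D * Nat.gcd q ΔH :=
      Nat.le_of_dvd (Nat.mul_pos (Nat.gcd_pos_of_pos_left _ (by omega))
        (Nat.gcd_pos_of_pos_left _ (by omega))) (Nat.gcd_mul_right_dvd_mul_gcd q D ΔH)
    have h2 : Nat.gcd q D ≤ Nat.gcd (∏ h ∈ H, d h) q := by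
      rw [Nat.gcd_comm (∏ h ∈ H, d h)]
      exact Nat.le_of_dvd (Nat.gcd_pos_of_pos_left _ (by omega)) (Nat.gcd_dvd_gcd_of_dvd_right _ hDP)
    have h3 : Nat.gcd q ΔH ≤ ΔH := Nat.gcd_le_right _ hΔH0
    calc ((Nat.gcd q R : ℕ) : ℝ) ≤ ((Nat.gcd q D * Nat.gcd q ΔH : ℕ) : ℝ) := by exact_mod_cast h1
      _ ≤ ((Nat.gcd (∏ h ∈ H, d h) q * ΔH : ℕ) : ℝ) := by exact_mod_cast Nat.mul_le_mul h2 h3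
      _ = _ := by push_cast; ring
  have hE1 : Mq ≤ ((2 : ℝ) ^ ((3 : ℝ) / 2) * Cδ ^ ℓ) * ((q : ℝ) ^ (ε / 4) * Real.sqrt q) * G *
      Real.sqrt ΔH := by
    calc Mq = (2 : ℝ) ^ ((3 : ℝ) / 2) * (ℓ : ℝ) ^ q.primeFactors.card * Real.sqrt q *
          Real.sqrt (Nat.gcd q R) := rfl
      _ ≤ (2 : ℝ) ^ ((3 : ℝ) / 2) * (Cδ ^ ℓ * (q : ℝ) ^ (ε / 4)) * Real.sqrt q *
          (G * Real.sqrt ΔH) := by gcongr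
      _ = _ := by ring
  -- (b) `1 + log q ≤ (1 + 4/ε) q^{ε/4}`
  have hE2 : 1 + Real.log q ≤ (1 + 4 / ε) * (q : ℝ) ^ (ε / 4) := one_add_log_le hq1 hε
  have hlog1 : 1 ≤ 1 + Real.log q := le_add_of_nonneg_right (Real.log_nonneg hq1)
  -- (c) `(m₁ + 1)/q + 1 ≤ 2 K X`
  have hpair : (∏ h ∈ H, (d h : ℝ)) ≤ (D : ℝ) * K := by
    have hgcdh : ∀ i ∈ H, ∀ j ∈ H.erase i, Nat.gcd (d i) (d j) ≤ hmax := by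
      intro i hi j hj
      have hji : j ≠ i := Finset.ne_of_mem_erase hj
      have hj' : j ∈ H := Finset.mem_of_mem_erase hj
      have h1 : Nat.gcd (d i) (d j) ∣ n₀ + i := (Nat.gcd_dvd_left _ _).trans (hsol₀ i hi)
      have h2 : Nat.gcd (d i) (d j) ∣ n₀ + j := (Nat.gcd_dvd_right _ _).trans (hsol₀ j hj')
      rcases lt_or_gt_of_ne hji with hlt | hlt
      · have h3 : Nat.gcd (d i) (d j) ∣ i - j := by
          have := Nat.dvd_sub h1 h2
          rwa [Nat.add_sub_add_left] at this
        exact (Nat.le_of_dvd (by omega) h3).trans (by have := hHle i hi; omega)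
      · have h3 : Nat.gcd (d i) (d j) ∣ j - i := by
          have := Nat.dvd_sub h2 h1
          rwa [Nat.add_sub_add_left] at this
        exact (Nat.le_of_dvd (by omega) h3).trans (by have := hHle j hj'; omega)
    have hpg : pairGcdProd H d ≤ hmax ^ (ℓH * ℓH) := by
      unfold pairGcdProd
      calc ∏ i ∈ H, ∏ j ∈ H.erase i, Nat.gcd (d i) (d j) ≤ ∏ i ∈ H, ∏ _j ∈ H.erase i, hmax :=
            Finset.prod_le_prod' fun i hi => Finset.prod_le_prod' fun j hj => hgcdh i hi j hj
        _ = hmax ^ (∑ i ∈ H, #(H.erase i)) := by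
            rw [Finset.prod_congr rfl fun i _ => Finset.prod_const hmax, Finset.prod_pow_eq_pow_sum]
        _ ≤ hmax ^ (ℓH * ℓH) := by
            refine Nat.pow_le_pow_right hhmax1 ?_
            calc ∑ i ∈ H, #(H.erase i) ≤ ∑ _i ∈ H, #H := Finset.sum_le_sum fun i _ => Finset.card_erase_le
              _ = ℓH * ℓH := by rw [Finset.sum_const, smul_eq_mul]
    have h1 := prod_le_lcm_mul_pairGcdProd H d hd
    have h2 : ((∏ h ∈ H, d h : ℕ) : ℝ) ≤ ((D * pairGcdProd H d : ℕ) : ℝ) := by exact_mod_cast h1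
    push_cast at h2
    refine h2.trans (mul_le_mul_of_nonneg_left ?_ (Nat.cast_nonneg _))
    rw [hK]; exact_mod_cast hpg
  have hD0R : (0 : ℝ) < D := by exact_mod_cast hD0
  have hE3 : ((m₁ : ℝ) + 1) / q + 1 ≤ 2 * K * X := by
    have hm1x : (m₁ : ℝ) ≤ x / D := by
      rw [hm₁]
      calc (((x - a) / D : ℕ) : ℝ) ≤ ((x - a : ℕ) : ℝ) / D := Nat.cast_div_le
        _ ≤ (x : ℝ) / D := by
            gcongr
            exact_mod_cast Nat.sub_le x a
    have hxD : (x : ℝ) / D ≤ K * ((x : ℝ) / ∏ h ∈ H, (d h : ℝ)) := by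
      rw [div_le_iff₀ hD0R]
      have h1 : 1 ≤ (D : ℝ) * K / ∏ h ∈ H, (d h : ℝ) := (one_le_div hPR).mpr hpair
      calc (x : ℝ) ≤ (x : ℝ) * ((D : ℝ) * K / ∏ h ∈ H, (d h : ℝ)) :=
            le_mul_of_one_le_right (Nat.cast_nonneg x) h1
        _ = K * ((x : ℝ) / ∏ h ∈ H, (d h : ℝ)) * D := by ring
    have hq1' : (1 : ℝ) / q ≤ 1 := by rw [div_le_one hqpos]; exact hq1
    calc ((m₁ : ℝ) + 1) / q + 1 ≤ ((x : ℝ) / D + 1) / q + 1 := by gcongr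
      _ = (x : ℝ) / D / q + 1 / q + 1 := by ring
      _ ≤ K * ((x : ℝ) / ∏ h ∈ H, (d h : ℝ)) / q + 1 + 1 := by gcongr
      _ = K * ((x : ℝ) / ((q : ℝ) * ∏ h ∈ H, (d h : ℝ))) + 2 := by
          rw [mul_div_assoc, div_div, mul_comm (∏ h ∈ H, (d h : ℝ)) (q : ℝ)]; ring
      _ ≤ 2 * K * X := by
          rw [hX]
          nlinarith [hK1, (by positivity : (0 : ℝ) ≤ (x : ℝ) / ((q : ℝ) * ∏ h ∈ H, (d h : ℝ)))]
  -- (d) `q^{ε/4} √q · q^{ε/4} ≤ q^{1/2+ε}`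
  have hE4 : ((q : ℝ) ^ (ε / 4) * Real.sqrt q) * (q : ℝ) ^ (ε / 4) ≤ (q : ℝ) ^ ((1 : ℝ) / 2 + ε) := by
    rw [Real.sqrt_eq_rpow, ← Real.rpow_add hqpos, ← Real.rpow_add hqpos]
    refine Real.rpow_le_rpow_of_exponent_le hq1 ?_
    linarith
  -- assemble
  rw [hS1, hS2, hS3]
  refine (Complex.abs_re_le_norm _).trans (hS4.trans ?_)
  have hm1nn : (0 : ℝ) ≤ ((m₁ : ℝ) + 1) / q := by positivity
  calc Mq * (((m₁ : ℝ) + 1) / q) + Mq * (1 + Real.log q)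
      ≤ Mq * (1 + Real.log q) * (((m₁ : ℝ) + 1) / q + 1) := by
        nlinarith [mul_nonneg (sub_nonneg.mpr hlog1) (mul_nonneg hMqnn hm1nn)]
    _ ≤ (((2 : ℝ) ^ ((3 : ℝ) / 2) * Cδ ^ ℓ) * ((q : ℝ) ^ (ε / 4) * Real.sqrt q) * G *
          Real.sqrt ΔH) * ((1 + 4 / ε) * (q : ℝ) ^ (ε / 4)) * (2 * K * X) := by
        refine mul_le_mul (mul_le_mul hE1 hE2 (by positivity) (by positivity)) hE3 (by positivity)
          (by positivity)
    _ = C * (((q : ℝ) ^ (ε / 4) * Real.sqrt q) * (q : ℝ) ^ (ε / 4)) * G * X := by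
        rw [hC]; ring
    _ ≤ C * (q : ℝ) ^ ((1 : ℝ) / 2 + ε) * G * X :=
        mul_le_mul_of_nonneg_right (mul_le_mul_of_nonneg_right
          (mul_le_mul_of_nonneg_left hE4 hC0) hG0.le) hX0.le

end Literature.Barriers.Parity
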